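import Summits.AtomisticToContinuum.FouriersLaw.Theorems.OddSectorIrreversibilityOddCorrectorDecayVariationAlgebra
import Literature.Analysis.ODE.IntegralGronwall

/-!
# Pathwise `ℓ¹` comparison of the open and the closed pinned chain started at the same phase point

Support file for item `stmt-AtomisticToContinuum-9139` (`OddSectorIrreversibility.OddCorrectorDecay`), negative
side, towards the bath-locality estimate `OddSectorBathLocality`. Deterministic statement (no probability): let
`z = (pinnedChain ω₂ lam β γ).chainFlow N x η` be the open chain driven by a continuous momentum-noise path `η`
(friction `γ ≥ 0` on the bath sites) and `y = (pinnedChain ω₂ lam β 0).chainFlow N x 0` the closed chain, both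
started at `x`. If along `[0, t₀]` the force difference is `ℓ¹`-Lipschitz with a continuous coefficient
`A ≥ 1`, `∑_i |∂_iΦ(z_q) - ∂_iΦ(y_q)| ≤ A(u) ∑_i |z_{q,i} - y_{q,i}|` (supplied by
`ChainVariation.sum_abs_dPotential_sub_le` with `A` a maximum of local curvatures), then for `s ∈ [0, t₀]`
`‖z(s) - y(s)‖_{ℓ¹} ≤ ‖F(s)‖_{ℓ¹} + (∫₀ˢ ‖F‖_{ℓ¹}) · exp(∫₀ˢ A)`,
where `F_i(u) = η_i(u) - γ ∫₀ᵘ w_i p_i(z(v)) dv` is the BOUNDARY forcing (noise minus friction impulse,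
supported on the bath sites `w_i ≠ 0`). The coefficient enters through its time integral only
(`Literature.Analysis.ODE.gronwall_integral_le`), which is what makes time-averaged exponential moments
(stationarity) sufficient downstream.
-/

noncomputable section

open MeasureTheory Set Filter Topology intervalIntegral Finset
open Literature.MathematicalPhysics.KineticTheory Literature.MathematicalPhysics.KineticTheory.HeatConduction
open Literature.Analysis.ODE OscillatorChain

namespace Summit.AtomisticToContinuum.FouriersLaw.Theorems.ChainVariation

variable {N : ℕ}

/-! ### Components of phase-space valued interval integrals -/

/-- `(∫ F).1 i = ∫ (F ·).1 i` for a continuous phase-space valued integrand. [folklore] -/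
theorem integral_fst_apply {F : ℝ → PhaseSpace N} (hF : Continuous F) (a b : ℝ) (i : Fin N) :
    (∫ v in a..b, F v).1 i = ∫ v in a..b, (F v).1 i := by
  set L : PhaseSpace N →L[ℝ] ℝ := (ContinuousLinearMap.proj i).comp (ContinuousLinearMap.fst ℝ _ _)
  calc (∫ v in a..b, F v).1 i = L (∫ v in a..b, F v) := rfl
    _ = ∫ v in a..b, L (F v) := (L.intervalIntegral_comp_comm (hF.intervalIntegrable a b)).symm
    _ = ∫ v in a..b, (F v).1 i := rfl

/-- `(∫ F).2 i = ∫ (F ·).2 i` for a continuous phase-space valued integrand. [folklore] -/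
theorem integral_snd_apply {F : ℝ → PhaseSpace N} (hF : Continuous F) (a b : ℝ) (i : Fin N) :
    (∫ v in a..b, F v).2 i = ∫ v in a..b, (F v).2 i := by
  set L : PhaseSpace N →L[ℝ] ℝ := (ContinuousLinearMap.proj i).comp (ContinuousLinearMap.snd ℝ _ _)
  calc (∫ v in a..b, F v).2 i = L (∫ v in a..b, F v) := rfl
    _ = ∫ v in a..b, L (F v) := (L.intervalIntegral_comp_comm (hF.intervalIntegrable a b)).symm
    _ = ∫ v in a..b, (F v).2 i := rfl

/-! ### The comparison -/

section Pathwise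

variable {ω₂ lam β γ : ℝ} (hω : 0 < ω₂) (hl : 0 ≤ lam) (hβ : 0 ≤ β) (hγ : 0 ≤ γ) (N)
include hω hl hβ hγ

/-- **Pathwise `ℓ¹` comparison, open vs. closed chain from the same point.** See the module docstring.
[folklore] -/
theorem ell1_open_closed_le (x : PhaseSpace N) {η : ℝ → Fin N → ℝ} (hη : Continuous η)
    {t₀ : ℝ} {A : ℝ → ℝ} (hAc : Continuous A) (hA1 : ∀ u, 1 ≤ A u)
    (hforce : ∀ u ∈ Icc (0:ℝ) t₀,
      ∑ i, |(pinnedChain ω₂ lam β γ).dPotential N i ((pinnedChain ω₂ lam β γ).chainFlow N x η u).1 -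
            (pinnedChain ω₂ lam β γ).dPotential N i ((pinnedChain ω₂ lam β 0).chainFlow N x 0 u).1| ≤
        A u * ∑ i, |((pinnedChain ω₂ lam β γ).chainFlow N x η u).1 i -
                    ((pinnedChain ω₂ lam β 0).chainFlow N x 0 u).1 i|) :
    ∀ s ∈ Icc (0:ℝ) t₀,
      (∑ i, |((pinnedChain ω₂ lam β γ).chainFlow N x η s).1 i - ((pinnedChain ω₂ lam β 0).chainFlow N x 0 s).1 i|) +
        ∑ i, |((pinnedChain ω₂ lam β γ).chainFlow N x η s).2 i - ((pinnedChain ω₂ lam β 0).chainFlow N x 0 s).2 i| ≤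
      (∑ i, |η s i - γ * ∫ v in (0:ℝ)..s,
          bathWeight N i * ((pinnedChain ω₂ lam β γ).chainFlow N x η v).2 i|) +
        (∫ u in (0:ℝ)..s, ∑ i, |η u i - γ * ∫ v in (0:ℝ)..u,
            bathWeight N i * ((pinnedChain ω₂ lam β γ).chainFlow N x η v).2 i|) *
          Real.exp (∫ u in (0:ℝ)..s, A u) := by
  intro s hs
  -- names
  set z : ℝ → PhaseSpace N := (pinnedChain ω₂ lam β γ).chainFlow N x η with hzdef
  set y : ℝ → PhaseSpace N := (pinnedChain ω₂ lam β 0).chainFlow N x 0 with hydef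
  have hzc : Continuous z := pinnedChain_continuous_chainFlow hω hl hβ hγ N x hη
  have h0c : Continuous (0 : ℝ → Fin N → ℝ) := continuous_const
  have hyc : Continuous y := pinnedChain_continuous_chainFlow hω hl hβ le_rfl N x (η := 0) h0c
  have hz := pinnedChain_isIntegralSolutionOn_chainFlow hω hl hβ hγ N x hη t₀
  have hy := pinnedChain_isIntegralSolutionOn_chainFlow hω hl hβ le_rfl N x (η := 0) h0c t₀
  have hUd : Differentiable ℝ (pinnedChain ω₂ lam β γ).U := (pinnedChain_contDiff_U ω₂ lam β γ (n := 1)).differentiable one_ne_zero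
  have hVd : Differentiable ℝ (pinnedChain ω₂ lam β γ).V := (pinnedChain_contDiff_V ω₂ lam β γ (n := 1)).differentiable one_ne_zero
  -- the drifts, componentwise
  have hdz1 : ∀ w : PhaseSpace N, ((pinnedChain ω₂ lam β γ).drift N w).1 = w.2 := fun w => rfl
  have hdz2 : ∀ (w : PhaseSpace N) (i : Fin N), ((pinnedChain ω₂ lam β γ).drift N w).2 i =
      -(pinnedChain ω₂ lam β γ).dPotential N i w.1 - γ * bathWeight N i * w.2 i := by
    intro w i
    simp only [OscillatorChain.drift, (pinnedChain ω₂ lam β γ).partialQ_hamiltonian_eq_dPotential hUd hVd]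
    rfl
  have hdy1 : ∀ w : PhaseSpace N, ((pinnedChain ω₂ lam β 0).drift N w).1 = w.2 := fun w => rfl
  have hdy2 : ∀ (w : PhaseSpace N) (i : Fin N), ((pinnedChain ω₂ lam β 0).drift N w).2 i =
      -(pinnedChain ω₂ lam β γ).dPotential N i w.1 := by
    intro w i
    have hUd0 : Differentiable ℝ (pinnedChain ω₂ lam β 0).U := hUd
    have hVd0 : Differentiable ℝ (pinnedChain ω₂ lam β 0).V := hVd
    simp only [OscillatorChain.drift, (pinnedChain ω₂ lam β 0).partialQ_hamiltonian_eq_dPotential hUd0 hVd0]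
    show -(pinnedChain ω₂ lam β 0).dPotential N i w.1 - 0 * bathWeight N i * w.2 i = _
    simp; rfl
  -- continuity of the various integrands
  have hdzc : Continuous fun v => (pinnedChain ω₂ lam β γ).drift N (z v) :=
    (pinnedChain_contDiff_drift ω₂ lam β γ N (n := 0)).continuous.comp hzc
  have hdyc : Continuous fun v => (pinnedChain ω₂ lam β 0).drift N (y v) :=
    (pinnedChain_contDiff_drift ω₂ lam β 0 N (n := 0)).continuous.comp hyc
  have hz2c : ∀ i, Continuous fun v => (z v).2 i := fun i =>
    (continuous_apply i).comp (continuous_snd.comp hzc)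
  have hy2c : ∀ i, Continuous fun v => (y v).2 i := fun i =>
    (continuous_apply i).comp (continuous_snd.comp hyc)
  have hdPc : ∀ i, Continuous fun v => (pinnedChain ω₂ lam β γ).dPotential N i (z v).1 -
      (pinnedChain ω₂ lam β γ).dPotential N i (y v).1 := by
    intro i
    have h := ((pinnedChain ω₂ lam β γ).contDiff_dPotential (pinnedChain_contDiff_U ω₂ lam β γ)
      (pinnedChain_contDiff_V ω₂ lam β γ) N i).continuous
    exact (h.comp (continuous_fst.comp hzc)).sub (h.comp (continuous_fst.comp hyc))
  -- (1) the position difference is the integral of the momentum difference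
  have hδq : ∀ u ∈ Icc (0:ℝ) t₀, ∀ i, (z u).1 i - (y u).1 i = ∫ v in (0:ℝ)..u, ((z v).2 i - (y v).2 i) := by
    intro u hu i
    have h1 := congrArg (fun w : PhaseSpace N => w.1 i) (hz u hu)
    have h2 := congrArg (fun w : PhaseSpace N => w.1 i) (hy u hu)
    simp only [OscillatorChain.forcing, Prod.fst_add, Pi.add_apply] at h1 h2
    rw [integral_fst_apply hdzc] at h1
    rw [integral_fst_apply hdyc] at h2
    simp only [hdz1, hdy1, Pi.zero_apply, add_zero] at h1 h2
    rw [integral_sub ((hz2c i).intervalIntegrable _ _) ((hy2c i).intervalIntegrable _ _)]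
    show (z u).1 i - (y u).1 i = _
    rw [h1, h2]; ring
  -- (2) the momentum difference is boundary forcing minus the integrated force difference
  have hδp : ∀ u ∈ Icc (0:ℝ) t₀, ∀ i, (z u).2 i - (y u).2 i =
      (η u i - γ * ∫ v in (0:ℝ)..u, bathWeight N i * (z v).2 i) -
        ∫ v in (0:ℝ)..u, ((pinnedChain ω₂ lam β γ).dPotential N i (z v).1 -
          (pinnedChain ω₂ lam β γ).dPotential N i (y v).1) := by
    intro u hu i
    have h1 := congrArg (fun w : PhaseSpace N => w.2 i) (hz u hu)
    have h2 := congrArg (fun w : PhaseSpace N => w.2 i) (hy u hu)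
    simp only [OscillatorChain.forcing, Prod.snd_add, Pi.add_apply] at h1 h2
    rw [integral_snd_apply hdzc] at h1
    rw [integral_snd_apply hdyc] at h2
    simp only [hdz2, hdy2, Pi.zero_apply, add_zero] at h1 h2
    have hc1 : Continuous fun v => (pinnedChain ω₂ lam β γ).dPotential N i (z v).1 :=
      ((pinnedChain ω₂ lam β γ).contDiff_dPotential (pinnedChain_contDiff_U ω₂ lam β γ)
        (pinnedChain_contDiff_V ω₂ lam β γ) N i).continuous.comp (continuous_fst.comp hzc)
    have hc2 : Continuous fun v => (pinnedChain ω₂ lam β γ).dPotential N i (y v).1 :=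
      ((pinnedChain ω₂ lam β γ).contDiff_dPotential (pinnedChain_contDiff_U ω₂ lam β γ)
        (pinnedChain_contDiff_V ω₂ lam β γ) N i).continuous.comp (continuous_fst.comp hyc)
    have hc3 : Continuous fun v => γ * bathWeight N i * (z v).2 i := continuous_const.mul (hz2c i)
    have e1 : ∫ v in (0:ℝ)..u, (-(pinnedChain ω₂ lam β γ).dPotential N i (z v).1 - γ * bathWeight N i * (z v).2 i) =
        -(∫ v in (0:ℝ)..u, (pinnedChain ω₂ lam β γ).dPotential N i (z v).1) -
          γ * ∫ v in (0:ℝ)..u, bathWeight N i * (z v).2 i := by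
      have hi1 : IntervalIntegrable (fun v => -(pinnedChain ω₂ lam β γ).dPotential N i (z v).1) volume 0 u := by
        exact (hc1.neg).intervalIntegrable _ _
      rw [integral_sub (f := fun v => -(pinnedChain ω₂ lam β γ).dPotential N i (z v).1)
        (g := fun v => γ * bathWeight N i * (z v).2 i) hi1 (hc3.intervalIntegrable _ _),
        intervalIntegral.integral_neg, ← intervalIntegral.integral_const_mul]
      congr 1
      exact intervalIntegral.integral_congr fun v _ => by ring
    have e2 : ∫ v in (0:ℝ)..u, -(pinnedChain ω₂ lam β γ).dPotential N i (y v).1 =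
        -(∫ v in (0:ℝ)..u, (pinnedChain ω₂ lam β γ).dPotential N i (y v).1) := intervalIntegral.integral_neg
    rw [integral_sub (hc1.intervalIntegrable _ _) (hc2.intervalIntegrable _ _)]
    show (z u).2 i - (y u).2 i = _
    rw [h1, h2, e1, e2]; ring
  -- (3) the scalar functions of the Grönwall argument
  set Fp : ℝ → Fin N → ℝ := fun u i => η u i - γ * ∫ v in (0:ℝ)..u, bathWeight N i * (z v).2 i with hFp
  set dq : ℝ → ℝ := fun u => ∑ i, |(z u).1 i - (y u).1 i| with hdq
  set W : ℝ → ℝ := fun u => ∑ i, |(z u).2 i - (y u).2 i - Fp u i| with hW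
  set g : ℝ → ℝ := fun u => dq u + W u with hg
  set hfun : ℝ → ℝ := fun u => ∫ v in (0:ℝ)..u, ∑ i, |Fp v i| with hhfun
  -- continuity
  have hFpc : ∀ i, Continuous fun u => Fp u i := by
    intro i
    have h1 : Continuous fun u => η u i := (continuous_apply i).comp hη
    have h2 : Continuous fun u => ∫ v in (0:ℝ)..u, bathWeight N i * (z v).2 i :=
      intervalIntegral.continuous_primitive (fun a b => ((continuous_const.mul (hz2c i)).intervalIntegrable a b)) 0
    exact h1.sub (continuous_const.mul h2)
  have hz1c : ∀ i, Continuous fun v => (z v).1 i := fun i => (continuous_apply i).comp (continuous_fst.comp hzc)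
  have hy1c : ∀ i, Continuous fun v => (y v).1 i := fun i => (continuous_apply i).comp (continuous_fst.comp hyc)
  have hdqc : Continuous dq := continuous_finsetSum _ fun i _ => ((hz1c i).sub (hy1c i)).abs
  have hWc : Continuous W := continuous_finsetSum _ fun i _ => (((hz2c i).sub (hy2c i)).sub (hFpc i)).abs
  have hgc : Continuous g := hdqc.add hWc
  have hFsum_c : Continuous fun v => ∑ i, |Fp v i| := continuous_finsetSum _ fun i _ => (hFpc i).abs
  have hδpc : ∀ i, Continuous fun v => (z v).2 i - (y v).2 i := fun i => (hz2c i).sub (hy2c i)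
  -- (a) positions: `dq u ≤ ∫₀ᵘ (W + ∑|Fp|)`
  have ha : ∀ u ∈ Icc (0:ℝ) t₀, dq u ≤ ∫ v in (0:ℝ)..u, (W v + ∑ i, |Fp v i|) := by
    intro u hu
    calc dq u = ∑ i, |∫ v in (0:ℝ)..u, ((z v).2 i - (y v).2 i)| := by
          simp only [hdq]
          exact Finset.sum_congr rfl fun i _ => by rw [hδq u hu i]
      _ ≤ ∑ i, ∫ v in (0:ℝ)..u, |(z v).2 i - (y v).2 i| :=
          Finset.sum_le_sum fun i _ => intervalIntegral.abs_integral_le_integral_abs hu.1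
      _ = ∫ v in (0:ℝ)..u, ∑ i, |(z v).2 i - (y v).2 i| := by
          rw [intervalIntegral.integral_finsetSum]
          exact fun i _ => ((hδpc i).abs).intervalIntegrable _ _
      _ ≤ ∫ v in (0:ℝ)..u, (W v + ∑ i, |Fp v i|) := by
          refine intervalIntegral.integral_mono_on hu.1
            ((continuous_finsetSum _ fun i _ => (hδpc i).abs).intervalIntegrable _ _)
            ((hWc.add hFsum_c).intervalIntegrable _ _) fun v _ => ?_
          simp only [hW]
          rw [← Finset.sum_add_distrib]
          refine Finset.sum_le_sum fun i _ => ?_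
          have e : (z v).2 i - (y v).2 i = ((z v).2 i - (y v).2 i - Fp v i) + Fp v i := by ring
          calc |(z v).2 i - (y v).2 i| = |((z v).2 i - (y v).2 i - Fp v i) + Fp v i| := by rw [← e]
            _ ≤ _ := abs_add_le _ _
  -- (b) momenta minus forcing: `W u ≤ ∫₀ᵘ A · dq`
  have hb : ∀ u ∈ Icc (0:ℝ) t₀, W u ≤ ∫ v in (0:ℝ)..u, A v * dq v := by
    intro u hu
    calc W u = ∑ i, |∫ v in (0:ℝ)..u, ((pinnedChain ω₂ lam β γ).dPotential N i (z v).1 -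
            (pinnedChain ω₂ lam β γ).dPotential N i (y v).1)| := by
          simp only [hW]
          refine Finset.sum_congr rfl fun i _ => ?_
          rw [hδp u hu i]
          simp only [hFp]
          rw [show ∀ a b : ℝ, |a - b - a| = |b| from fun a b => by rw [sub_sub_cancel_left, abs_neg]]
      _ ≤ ∑ i, ∫ v in (0:ℝ)..u, |(pinnedChain ω₂ lam β γ).dPotential N i (z v).1 -
            (pinnedChain ω₂ lam β γ).dPotential N i (y v).1| :=
          Finset.sum_le_sum fun i _ => intervalIntegral.abs_integral_le_integral_abs hu.1
      _ = ∫ v in (0:ℝ)..u, ∑ i, |(pinnedChain ω₂ lam β γ).dPotential N i (z v).1 -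
            (pinnedChain ω₂ lam β γ).dPotential N i (y v).1| := by
          rw [intervalIntegral.integral_finsetSum]
          exact fun i _ => ((hdPc i).abs).intervalIntegrable _ _
      _ ≤ ∫ v in (0:ℝ)..u, A v * dq v := by
          refine intervalIntegral.integral_mono_on hu.1
            ((continuous_finsetSum _ fun i _ => (hdPc i).abs).intervalIntegrable _ _)
            ((hAc.mul hdqc).intervalIntegrable _ _) fun v hv => ?_
          exact hforce v ⟨hv.1, hv.2.trans hu.2⟩
  -- (c) the Grönwall inequality for `g = dq + W`
  have hc : ∀ u ∈ Icc (0:ℝ) s, g u ≤ hfun u + ∫ v in (0:ℝ)..u, A v * g v := by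
    intro u hu
    have hu' : u ∈ Icc (0:ℝ) t₀ := ⟨hu.1, hu.2.trans hs.2⟩
    have h1 := ha u hu'
    have h2 := hb u hu'
    have hsplit : ∫ v in (0:ℝ)..u, (W v + ∑ i, |Fp v i|) = (∫ v in (0:ℝ)..u, W v) + hfun u := by
      simp only [hhfun]
      exact intervalIntegral.integral_add (hWc.intervalIntegrable _ _) (hFsum_c.intervalIntegrable _ _)
    have hiAdq : IntervalIntegrable (fun v => A v * dq v) volume 0 u := by
      exact (hAc.mul hdqc).intervalIntegrable _ _
    have hiAg : IntervalIntegrable (fun v => A v * g v) volume 0 u := by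
      exact (hAc.mul hgc).intervalIntegrable _ _
    have hiWAdq : IntervalIntegrable (fun v => W v + A v * dq v) volume 0 u := by
      exact (hWc.add (hAc.mul hdqc)).intervalIntegrable _ _
    have h3 : (∫ v in (0:ℝ)..u, W v) + ∫ v in (0:ℝ)..u, A v * dq v ≤ ∫ v in (0:ℝ)..u, A v * g v := by
      rw [← intervalIntegral.integral_add (hWc.intervalIntegrable _ _) hiAdq]
      refine intervalIntegral.integral_mono_on hu.1 hiWAdq hiAg fun v _ => ?_
      simp only [hg]
      have hW0 : 0 ≤ W v := Finset.sum_nonneg fun i _ => abs_nonneg _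
      have := hA1 v
      nlinarith
    simp only [hg] at h3 ⊢
    linarith
  have hmono : MonotoneOn hfun (Icc 0 s) := by
    intro u hu u' hu' huu'
    simp only [hhfun]
    have hadd := intervalIntegral.integral_add_adjacent_intervals (μ := volume) (a := (0:ℝ)) (b := u) (c := u')
      (hFsum_c.intervalIntegrable _ _) (hFsum_c.intervalIntegrable _ _)
    have : 0 ≤ ∫ v in u..u', ∑ i, |Fp v i| :=
      intervalIntegral.integral_nonneg huu' fun v _ => Finset.sum_nonneg fun i _ => abs_nonneg _
    linarith
  have hA0 : ∀ u, 0 ≤ A u := fun u => zero_le_one.trans (hA1 u)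
  have key := gronwall_integral_le hs.1 hAc hgc hA0 hmono hc
  -- (d) conclude
  have hfin : (∑ i, |(z s).1 i - (y s).1 i|) + ∑ i, |(z s).2 i - (y s).2 i| ≤ g s + ∑ i, |Fp s i| := by
    have hp : ∑ i, |(z s).2 i - (y s).2 i| ≤ ∑ i, (|(z s).2 i - (y s).2 i - Fp s i| + |Fp s i|) := by
      refine Finset.sum_le_sum fun i _ => ?_
      have e : (z s).2 i - (y s).2 i = ((z s).2 i - (y s).2 i - Fp s i) + Fp s i := by ring
      calc |(z s).2 i - (y s).2 i| = |((z s).2 i - (y s).2 i - Fp s i) + Fp s i| := by rw [← e]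
        _ ≤ _ := abs_add_le _ _
    rw [Finset.sum_add_distrib] at hp
    simp only [hg, hdq, hW]
    linarith
  calc (∑ i, |(z s).1 i - (y s).1 i|) + ∑ i, |(z s).2 i - (y s).2 i| ≤ g s + ∑ i, |Fp s i| := hfin
    _ ≤ hfun s * Real.exp (∫ u in (0:ℝ)..s, A u) + ∑ i, |Fp s i| := add_le_add key le_rfl
    _ = _ := by simp only [hhfun, hFp]; ring

end Pathwise

end Summit.AtomisticToContinuum.FouriersLaw.Theorems.ChainVariation

end
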